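import Mathlib
import Summits.Ventures.HodgeRepro.Tier4.Common.AdelicDefs
import Summits.Ventures.HodgeRepro.Tier4.Common.AdelicHaar
import Summits.Ventures.HodgeRepro.Tier4.Common.SettingOfData
import Summits.Ventures.HodgeRepro.Tier4.Line1.SecondCountableGA
import Summits.Ventures.HodgeRepro.Tier4.Line1.RationalPoints
import Summits.Ventures.HodgeRepro.Tier4.Line1.CocompactReduction
import Summits.Ventures.HodgeRepro.Tier4.Common.LpInfiniteOfHaar

/-!
# Tier4/Line4/LpInfiniteDisplay — display (10) `l4_lpInfinite` modulo the non-discreteness of `G(𝔸)`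

Blind re-derivation cell `pub-hodge-repro`, Tier 4 «PROVE THE STEP» (README §9–§10), LINE L4, seat t4-L3-p1 (gen 3),
cut C-L4-LPINF (plan-4 S15084 / lead S15050; bus S15096): the `G(𝔸)` half (B) of display (10).

* `measure_pos_of_isFundamentalDomain_rationalPoints`: a fundamental domain of the countable `G(k)` in `G(𝔸)` has
  positive Haar measure (the translates cover a.e., left invariance, Haar is positive on the whole group);
* `lpInfinite_of_nonDiscrete`: display (10) of the L4 skeleton, `¬ FiniteDimensional ℂ (Lp ℂ 2 (SS.μ.restrict SS.DG))`
  for `SS = Setting.ofAdelicData W R μ DG fdG compG compT compT'`, under ONE displayed binder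
  `hnd : (𝓝[≠] (1 : GA W)).NeBot` («`1` is not isolated in `G(𝔸)`» — the archimedean torus is an infinite compact
  group; not yet a tree theorem): the generic `Common.not_finiteDimensional_Lp_restrict_of_isHaarMeasure` on a measurable
  core of the (null-measurable) fundamental domain, which has positive measure and compact closure.

Imports: Mathlib, `Common/{AdelicDefs, AdelicHaar, SettingOfData, LpInfiniteOfHaar}`, `Line1/{SecondCountableGA,
RationalPoints, CocompactReduction}` by name.  `#print axioms` = `[propext, Classical.choice, Quot.sound]`.  No printed
input is consumed.  Nothing here asserts anything about the truth of (P); HC_CM is NOT proved by anyone in this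
repository.
-/

set_option autoImplicit false

noncomputable section

namespace Summit.Ventures.HodgeRepro.Tier4.Line4

open Summit.Ventures.HodgeRepro.Tier4.Common Summit.Ventures.HodgeRepro.Tier4.Line1 MeasureTheory Topology Filter Set

variable {k : Type} [Field k] [NumberField k] (W : PlaneData k)

/-- **A fundamental domain of `G(k)` in `G(𝔸)` has positive Haar measure**: the countably many translates cover
almost everything, and Haar measure is positive on the whole group. -/
theorem measure_pos_of_isFundamentalDomain_rationalPoints [MeasurableSpace (GA W)] [BorelSpace (GA W)]
    (μ : Measure (GA W)) [μ.IsHaarMeasure] {DG : Set (GA W)}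
    (fdG : IsFundamentalDomain (rationalPoints W) DG μ) : 0 < μ DG := by
  haveI : Countable (rationalPoints W) := rationalPoints_countable W
  rw [pos_iff_ne_zero]
  intro h0
  -- the a.e.-cover by the translates `γ⁻¹ • DG`
  have hcov : ∀ᵐ x ∂μ, ∃ γ : rationalPoints W, γ • x ∈ DG := fdG.ae_covers
  have hnull : μ {x : GA W | ∃ γ : rationalPoints W, γ • x ∈ DG} = 0 := by
    have hsub : {x : GA W | ∃ γ : rationalPoints W, γ • x ∈ DG} ⊆
        ⋃ γ : rationalPoints W, (fun x : GA W => (γ : GA W) * x) ⁻¹' DG := by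
      intro x hx
      obtain ⟨γ, hγ⟩ := hx
      exact mem_iUnion.2 ⟨γ, hγ⟩
    refine measure_mono_null hsub (measure_iUnion_null fun γ => ?_)
    rw [measure_preimage_mul μ (γ : GA W) DG]
    exact h0
  have huniv : μ (univ : Set (GA W)) = 0 := by
    have h1 : μ {x : GA W | ¬ ∃ γ : rationalPoints W, γ • x ∈ DG} = 0 := hcov
    have : (univ : Set (GA W)) ⊆ {x : GA W | ∃ γ : rationalPoints W, γ • x ∈ DG} ∪
        {x : GA W | ¬ ∃ γ : rationalPoints W, γ • x ∈ DG} := fun x _ => by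
      by_cases h : ∃ γ : rationalPoints W, γ • x ∈ DG
      · exact Or.inl h
      · exact Or.inr h
    exact measure_mono_null this (measure_union_null hnull h1)
  exact (isOpen_univ.measure_pos μ univ_nonempty).ne' huniv

/-- **v0.33 display (10), MODULO THE NON-DISCRETENESS OF `G(𝔸)`** (`hnd : (𝓝[≠] 1).NeBot`): `L²(D_G)` of the setting of
the defined objects is infinite-dimensional — the generic `not_finiteDimensional_Lp_restrict_of_isHaarMeasure` on a
measurable core of the (null-measurable) fundamental domain, of positive measure by the lemma above and of compact
closure by `compG`. -/
theorem lpInfinite_of_nonDiscrete [MeasurableSpace (GA W)] [BorelSpace (GA W)] (R : RTFData W)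
    (μ : Measure (GA W)) [μ.IsHaarMeasure] [R.μT.IsHaarMeasure] [R.μT'.IsHaarMeasure] (DG : Set (GA W))
    (fdG : IsFundamentalDomain (rationalPoints W) DG μ) (compG : IsCompact (closure DG))
    (compT : IsCompact (closure R.DT)) (compT' : IsCompact (closure R.DT'))
    (hnd : (𝓝[≠] (1 : GA W)).NeBot) :
    ¬ FiniteDimensional ℂ (Lp ℂ 2 ((Setting.ofAdelicData W R μ DG fdG compG compT compT').μ.restrict
      (Setting.ofAdelicData W R μ DG fdG compG compT compT').DG)) := by
  haveI := t2Space_GA W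
  haveI := locallyCompactSpace_GA W
  haveI := secondCountable_GA W
  haveI := hnd
  show ¬ FiniteDimensional ℂ (Lp ℂ 2 (μ.restrict DG))
  -- a measurable core of the null-measurable fundamental domain
  obtain ⟨t, htDG, htm, hteq⟩ := fdG.nullMeasurableSet.exists_measurable_subset_ae_eq
  rw [Measure.restrict_congr_set hteq.symm]
  have hpos : 0 < μ t := by
    rw [measure_congr hteq]
    exact measure_pos_of_isFundamentalDomain_rationalPoints W μ fdG
  exact not_finiteDimensional_Lp_restrict_of_isHaarMeasure μ htm
    (compG.of_isClosed_subset isClosed_closure (closure_mono htDG)) hpos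

end Summit.Ventures.HodgeRepro.Tier4.Line4


end
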